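import Mathlib
import HarnessLib

/-!
# Zero-frequency storage decay ⇒ upper Abel modulus, part 1: the real-analysis core
# (line `abel-storage-decay`, crux `VanishingNoiseTransfer.NoisyFourier`, stmt-AtomisticToContinuum-11977)

`--supports stmt-AtomisticToContinuum-11977` file (lead c6; the statements and proofs of this part were written in
the crux workfile `Cruxes/NoisyFourier/Lines/abel_storage_decay.lean` by the crux-strategist seat s3 and by lead c5
and are landed here unchanged up to lint, so that the line's skeleton reduces to imports + registered stubs).

Pure real analysis, no chain objects:

* `rpow_tangent_le` — tangent (Bernoulli) inequality of the concave power, `a(y − x)y^{a−1} ≤ y^a − x^a`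
  (`0 < x ≤ y`, `0 < a ≤ 1`);
* `rpow_sub_one_le_two_mul` — `t^{a−1} ≤ 2 t'^{a−1}` for `0 < t' ≤ 2t`;
* `step_le`, `telescope_le` — if `(σ t' − σ t)² ≤ (t' − t)² N_t N_{t'}` (`0 < t ≤ t' ≤ 1`) and the "storage"
  bound `t N_t ≤ C t^a` holds on `(0,1]`, then `σ s' − σ s ≤ (2C/a) s'^a` for all `0 < s ≤ s' ≤ 1` (uniform
  partition of mesh `≤ s`, the tangent inequality on each step, telescope). Applied in part 2
  (`…NoisyFourierOfStorageDecay`) with `σ = ` the Abel–Green–Kubo pairing `s ↦ ∫ J_L u_{L,s} dμ_T` and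
  `N_t = ∫ u_{L,t}² dμ_T`, this is `U⁺ ⇒ U` (zero-frequency storage decay ⇒ upper Abel modulus at `0⁺`).
* `abel_mooreOsgood_floorD` — the one-sided Abel–Moore–Osgood transfer of lead c5 with the floor moved to the
  Abel limits: one-sided monotone `K_N(·)` with an `N`-uniform upper modulus at `0⁺`, Abel limits `D_N`,
  fixed-`s` limits in `N` and an eventual floor `c ≤ D_N` force `D_N → κ > 0`.

Folklore; no definitions; axioms `propext`, `Classical.choice`, `Quot.sound` only.
-/

noncomputable section

open Filter Topology Finset
open scoped BigOperators

namespace Summit.AtomisticToContinuum.FouriersLaw.Theorems.NoisyFourier.StorageDecay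

/-! ## The telescope -/

/-- Tangent (Bernoulli) inequality for the concave power `x ↦ x^a`, `0 < a ≤ 1`:
`a (y − x) y^{a−1} ≤ y^a − x^a` for `0 < x ≤ y` (weighted AM–GM `r^a ≤ a r + (1 − a)`, `r = x/y`). [folklore] -/
theorem rpow_tangent_le {x y a : ℝ} (hx : 0 < x) (hxy : x ≤ y) (ha : 0 < a) (ha1 : a ≤ 1) :
    a * (y - x) * y ^ (a - 1) ≤ y ^ a - x ^ a := by
  have hy : 0 < y := lt_of_lt_of_le hx hxy
  set r : ℝ := x / y with hr
  have hr0 : 0 ≤ r := div_nonneg hx.le hy.le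
  have hamgm : r ^ a * (1 : ℝ) ^ (1 - a) ≤ a * r + (1 - a) * 1 :=
    Real.geom_mean_le_arith_mean2_weighted ha.le (by linarith) hr0 zero_le_one (by ring)
  rw [Real.one_rpow, mul_one, mul_one] at hamgm
  have hya0 : 0 < y ^ a := Real.rpow_pos_of_pos hy a
  have hxa : x ^ a = r ^ a * y ^ a := by
    rw [hr, Real.div_rpow hx.le hy.le, div_mul_cancel₀ _ hya0.ne']
  have hya1 : y ^ (a - 1) = y ^ a / y := Real.rpow_sub_one hy.ne' a
  have hyx : y - x = y * (1 - r) := by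
    rw [hr]; field_simp
  rw [hxa, hya1, hyx]
  have e : a * (y * (1 - r)) * (y ^ a / y) = a * (1 - r) * y ^ a := by
    field_simp
  rw [e]
  have h2 : r ^ a * y ^ a ≤ (a * r + (1 - a)) * y ^ a := mul_le_mul_of_nonneg_right hamgm hya0.le
  nlinarith [h2]

/-- Halving the base at a nonpositive exponent costs at most a factor `2`:
for `0 < t' ≤ 2t` and `0 < a ≤ 1`, `t^{a−1} ≤ 2 · t'^{a−1}`. [folklore] -/
theorem rpow_sub_one_le_two_mul {t t' a : ℝ} (ht' : 0 < t') (h2 : t' ≤ 2 * t)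
    (ha : 0 < a) (ha1 : a ≤ 1) : t ^ (a - 1) ≤ 2 * t' ^ (a - 1) := by
  have hhalf : t' / 2 ≤ t := by linarith
  have hhalf0 : 0 < t' / 2 := by positivity
  -- `t^{a-1} ≤ (t'/2)^{a-1}` (exponent `≤ 0` reverses the base order)
  have h1 : t ^ (a - 1) ≤ (t' / 2) ^ (a - 1) :=
    Real.rpow_le_rpow_of_nonpos hhalf0 hhalf (by linarith)
  -- `(t'/2)^{a-1} = t'^{a-1} * 2^{1-a} ≤ 2 t'^{a-1}`
  have h2 : (t' / 2) ^ (a - 1) = t' ^ (a - 1) * (2 : ℝ) ^ (1 - a) := by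
    rw [Real.div_rpow ht'.le (by norm_num : (0:ℝ) ≤ 2)]
    rw [show (1 : ℝ) - a = -(a - 1) by ring, Real.rpow_neg (by norm_num : (0:ℝ) ≤ 2)]
    rw [div_eq_mul_inv]
  have h3 : (2 : ℝ) ^ (1 - a) ≤ 2 := by
    calc (2 : ℝ) ^ (1 - a) ≤ (2 : ℝ) ^ (1 : ℝ) :=
          Real.rpow_le_rpow_of_exponent_le (by norm_num) (by linarith)
      _ = 2 := Real.rpow_one 2
  have h4 : 0 ≤ t' ^ (a - 1) := (Real.rpow_pos_of_pos ht' _).le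
  calc t ^ (a - 1) ≤ t' ^ (a - 1) * (2 : ℝ) ^ (1 - a) := h2 ▸ h1
    _ ≤ t' ^ (a - 1) * 2 := mul_le_mul_of_nonneg_left h3 h4
    _ = 2 * t' ^ (a - 1) := by ring

/-- ONE STEP of the telescope: if `(σ t' − σ t)² ≤ (t' − t)² N_t N_{t'}` and `t N_t ≤ C t^a` on `(0,1]`, then for
`0 < t ≤ t' ≤ min(2t, 1)`: `σ t' − σ t ≤ (2C/a)(t'^a − t^a)`. [folklore] -/
theorem step_le {σ N : ℝ → ℝ} {a C : ℝ} (ha : 0 < a) (ha1 : a ≤ 1) (hC : 0 ≤ C)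
    (hN : ∀ t, 0 < t → t ≤ 1 → t * N t ≤ C * t ^ a)
    (hN0 : ∀ t, 0 < t → t ≤ 1 → 0 ≤ N t)
    (hstep : ∀ t t', 0 < t → t ≤ t' → t' ≤ 1 → (σ t' - σ t) ^ 2 ≤ (t' - t) ^ 2 * (N t * N t'))
    {t t' : ℝ} (ht : 0 < t) (htt' : t ≤ t') (h2 : t' ≤ 2 * t) (ht'1 : t' ≤ 1) :
    σ t' - σ t ≤ 2 * C / a * (t' ^ a - t ^ a) := by
  have ht' : 0 < t' := lt_of_lt_of_le ht htt'
  have ht1 : t ≤ 1 := htt'.trans ht'1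
  -- `N t ≤ C t^{a-1}`, `N t' ≤ C t'^{a-1}`
  have hNle : ∀ τ, 0 < τ → τ ≤ 1 → N τ ≤ C * τ ^ (a - 1) := by
    intro τ hτ hτ1
    have h := hN τ hτ hτ1
    rw [Real.rpow_sub_one hτ.ne', mul_div_assoc', le_div_iff₀ hτ]
    linarith
  have hNt := hNle t ht ht1
  have hNt' := hNle t' ht' ht'1
  have hpow : t ^ (a - 1) ≤ 2 * t' ^ (a - 1) := rpow_sub_one_le_two_mul ht' h2 ha ha1
  have hB0 : 0 ≤ t' ^ (a - 1) := (Real.rpow_pos_of_pos ht' _).le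
  -- `N t * N t' ≤ (2 C t'^{a-1})^2`
  have hprod : N t * N t' ≤ (2 * C * t' ^ (a - 1)) ^ 2 := by
    have h1 : N t ≤ 2 * C * t' ^ (a - 1) := by
      calc N t ≤ C * t ^ (a - 1) := hNt
        _ ≤ C * (2 * t' ^ (a - 1)) := mul_le_mul_of_nonneg_left hpow hC
        _ = 2 * C * t' ^ (a - 1) := by ring
    have h2' : N t' ≤ 2 * C * t' ^ (a - 1) := by
      calc N t' ≤ C * t' ^ (a - 1) := hNt'
        _ ≤ 2 * C * t' ^ (a - 1) := by nlinarith [mul_nonneg hC hB0]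
    calc N t * N t' ≤ (2 * C * t' ^ (a - 1)) * (2 * C * t' ^ (a - 1)) :=
          mul_le_mul h1 h2' (hN0 t' ht' ht'1) (by positivity)
      _ = (2 * C * t' ^ (a - 1)) ^ 2 := by ring
  -- hence `σ t' - σ t ≤ (t' - t) * 2 C t'^{a-1}`
  have hsq : (σ t' - σ t) ^ 2 ≤ ((t' - t) * (2 * C * t' ^ (a - 1))) ^ 2 := by
    calc (σ t' - σ t) ^ 2 ≤ (t' - t) ^ 2 * (N t * N t') := hstep t t' ht htt' ht'1
      _ ≤ (t' - t) ^ 2 * (2 * C * t' ^ (a - 1)) ^ 2 :=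
          mul_le_mul_of_nonneg_left hprod (sq_nonneg _)
      _ = ((t' - t) * (2 * C * t' ^ (a - 1))) ^ 2 := by ring
  have hR0 : 0 ≤ (t' - t) * (2 * C * t' ^ (a - 1)) := by
    have : 0 ≤ t' - t := by linarith
    positivity
  have hlin : σ t' - σ t ≤ (t' - t) * (2 * C * t' ^ (a - 1)) :=
    (abs_le_of_sq_le_sq' hsq hR0).2
  -- Bernoulli: `(t' - t) t'^{a-1} ≤ (t'^a - t^a)/a`
  have hber : a * (t' - t) * t' ^ (a - 1) ≤ t' ^ a - t ^ a := rpow_tangent_le ht htt' ha ha1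
  have hfin : (t' - t) * (2 * C * t' ^ (a - 1)) ≤ 2 * C / a * (t' ^ a - t ^ a) := by
    rw [div_mul_eq_mul_div, le_div_iff₀ ha]
    have : (t' - t) * (2 * C * t' ^ (a - 1)) * a = 2 * C * (a * (t' - t) * t' ^ (a - 1)) := by ring
    rw [this]
    exact mul_le_mul_of_nonneg_left hber (by positivity)
  exact hlin.trans hfin

/-- THE TELESCOPE: under the same hypotheses, `σ s' − σ s ≤ (2C/a) s'^a` for all `0 < s ≤ s' ≤ 1`
(uniform partition of `[s, s']` with mesh `≤ s`, `step_le` on each step, telescoping `Σ (t_{k+1}^a − t_k^a)`).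
[folklore] -/
theorem telescope_le {σ N : ℝ → ℝ} {a C : ℝ} (ha : 0 < a) (ha1 : a ≤ 1) (hC : 0 ≤ C)
    (hN : ∀ t, 0 < t → t ≤ 1 → t * N t ≤ C * t ^ a)
    (hN0 : ∀ t, 0 < t → t ≤ 1 → 0 ≤ N t)
    (hstep : ∀ t t', 0 < t → t ≤ t' → t' ≤ 1 → (σ t' - σ t) ^ 2 ≤ (t' - t) ^ 2 * (N t * N t'))
    {s s' : ℝ} (hs : 0 < s) (hss' : s ≤ s') (hs'1 : s' ≤ 1) :
    σ s' - σ s ≤ 2 * C / a * s' ^ a := by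
  -- the partition
  set n : ℕ := ⌈(s' - s) / s⌉₊ + 1 with hn
  have hn1 : 1 ≤ n := by omega
  have hn0 : (0 : ℝ) < n := by exact_mod_cast hn1
  set h : ℝ := (s' - s) / n with hh
  have hh0 : 0 ≤ h := div_nonneg (by linarith) hn0.le
  have hhs : h ≤ s := by
    rw [hh, div_le_iff₀ hn0]
    have hceil : (s' - s) / s ≤ (⌈(s' - s) / s⌉₊ : ℝ) := Nat.le_ceil _
    have hcn : (⌈(s' - s) / s⌉₊ : ℝ) ≤ n := by
      rw [hn]; push_cast; linarith
    have : (s' - s) / s ≤ n := hceil.trans hcn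
    rw [div_le_iff₀ hs] at this
    linarith
  set t : ℕ → ℝ := fun k => s + k * h with ht
  have ht0 : t 0 = s := by simp [ht]
  have htn : t n = s' := by
    simp only [ht, hh]
    field_simp
    ring
  have htpos : ∀ k, 0 < t k := fun k => by
    simp only [ht]; positivity
  have htmono : ∀ k, t k ≤ t (k + 1) := fun k => by
    simp only [ht]; push_cast; nlinarith
  have ht2 : ∀ k, t (k + 1) ≤ 2 * t k := fun k => by
    simp only [ht]; push_cast
    have : (k : ℝ) * h ≥ 0 := by positivity
    nlinarith
  have htle : ∀ k, k ≤ n → t k ≤ s' := fun k hk => by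
    rw [← htn]
    simp only [ht]
    have : (k : ℝ) ≤ n := by exact_mod_cast hk
    nlinarith
  -- telescoping
  have hsum : σ s' - σ s = ∑ k ∈ range n, (σ (t (k + 1)) - σ (t k)) := by
    rw [Finset.sum_range_sub (fun k => σ (t k)) n, htn, ht0]
  have hsum' : ∑ k ∈ range n, ((t (k + 1)) ^ a - (t k) ^ a) = s' ^ a - s ^ a := by
    rw [Finset.sum_range_sub (fun k => (t k) ^ a) n, htn, ht0]
  have hle : ∑ k ∈ range n, (σ (t (k + 1)) - σ (t k)) ≤
      ∑ k ∈ range n, (2 * C / a * ((t (k + 1)) ^ a - (t k) ^ a)) := by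
    refine Finset.sum_le_sum fun k hk => ?_
    have hkn : k + 1 ≤ n := Nat.succ_le_of_lt (Finset.mem_range.mp hk)
    exact step_le ha ha1 hC hN hN0 hstep (htpos k) (htmono k) (ht2 k) ((htle (k + 1) hkn).trans hs'1)
  rw [hsum]
  refine hle.trans ?_
  rw [← Finset.mul_sum, hsum']
  have hsa : 0 ≤ s ^ a := (Real.rpow_pos_of_pos hs a).le
  have hCa : 0 ≤ 2 * C / a := by positivity
  nlinarith [mul_nonneg hCa hsa]



/-! ## One-sided Abel–Moore–Osgood transfer with the floor on the Abel limits -/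

/-- **One-sided Abel–Moore–Osgood transfer** (pure real analysis, lead c5): if, eventually in `N`, the functions
`K_N` satisfy the one-sided bound `K_N(s') − K_N(s) ≥ −C(s' − s)` (`0 < s ≤ s' ≤ 1`), admit for every `η > 0`
a scale `s₀` below which they increase by at most `η` (eventually in `N`), have Abel limits `K_N(0⁺) = D_N`,
converge in `N` at each fixed `s ∈ (0,1]`, and the Abel limits `D_N` are eventually bounded below by `c > 0`, then
`D_N` converges to a positive limit. (Lead c5's `abel_mooreOsgood_oneSided` with the floor moved from `K_N(s)` to
`D_N`; pure real analysis.) [folklore] -/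
theorem abel_mooreOsgood_floorD (K : ℕ → ℝ → ℝ) (D : ℕ → ℝ) (C c : ℝ) (hc : 0 < c)
    (hmono : ∀ᶠ N in atTop, ∀ s s' : ℝ, 0 < s → s ≤ s' → s' ≤ 1 → -(C * (s' - s)) ≤ K N s' - K N s)
    (hupper : ∀ η : ℝ, 0 < η → ∃ s₀ : ℝ, 0 < s₀ ∧ s₀ ≤ 1 ∧
      ∀ᶠ N in atTop, ∀ s s' : ℝ, 0 < s → s ≤ s' → s' ≤ s₀ → K N s' - K N s ≤ η)
    (habel : ∀ᶠ N in atTop, Tendsto (K N) (𝓝[>] 0) (𝓝 (D N)))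
    (htl : ∀ s : ℝ, 0 < s → s ≤ 1 → ∃ Λ : ℝ, Tendsto (fun N => K N s) atTop (𝓝 Λ))
    (hfloor : ∀ᶠ N in atTop, c ≤ D N) :
    ∃ κ : ℝ, 0 < κ ∧ Tendsto D atTop (𝓝 κ) := by
  set C' : ℝ := max C 1 with hC'
  have hC'pos : 0 < C' := lt_of_lt_of_le one_pos (le_max_right _ _)
  have hCC' : C ≤ C' := le_max_left _ _
  haveI : (𝓝[>] (0 : ℝ)).NeBot := nhdsGT_neBot 0
  -- (a) lower semicontinuity at `0⁺`, FREE from the one-sided bound: `D N ≤ K N s + C' s`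
  have hA : ∀ᶠ N in atTop, ∀ s : ℝ, 0 < s → s ≤ 1 → D N ≤ K N s + C' * s := by
    filter_upwards [hmono, habel] with N hm ha s hs hs1
    have hev : ∀ᶠ s'' in 𝓝[>] (0 : ℝ), K N s'' ≤ K N s + C' * s := by
      have hmem : Set.Ioc (0 : ℝ) s ∈ 𝓝[>] (0 : ℝ) := Ioc_mem_nhdsGT hs
      filter_upwards [hmem] with s'' hs''
      have h := hm s'' s hs''.1 hs''.2 hs1
      have h2 : C * (s - s'') ≤ C' * s := by
        rcases le_or_gt 0 C with hC0 | hC0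
        · calc C * (s - s'') ≤ C * s := mul_le_mul_of_nonneg_left (by linarith [hs''.1]) hC0
            _ ≤ C' * s := mul_le_mul_of_nonneg_right hCC' hs.le
        · have : C * (s - s'') ≤ 0 := mul_nonpos_of_nonpos_of_nonneg hC0.le (by linarith [hs''.2])
          linarith [mul_pos hC'pos hs]
      linarith
    exact le_of_tendsto ha hev
  -- (b) upper semicontinuity at `0⁺` from `hupper`: for every `η > 0` a scale `s ∈ (0,1]` with
  --     `|D N - K N s| ≤ η` eventually in `N`
  have hB : ∀ η : ℝ, 0 < η → ∃ s : ℝ, 0 < s ∧ s ≤ 1 ∧ ∀ᶠ N in atTop, |D N - K N s| ≤ η := by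
    intro η hη
    obtain ⟨s₀, hs₀, hs₀1, hup⟩ := hupper (η / 2) (by positivity)
    set s : ℝ := min s₀ (η / (2 * C')) with hsdef
    have hs : 0 < s := lt_min hs₀ (by positivity)
    have hss₀ : s ≤ s₀ := min_le_left _ _
    have hs1 : s ≤ 1 := hss₀.trans hs₀1
    have hsC : C' * s ≤ η / 2 := by
      calc C' * s ≤ C' * (η / (2 * C')) := mul_le_mul_of_nonneg_left (min_le_right _ _) hC'pos.le
        _ = η / 2 := by field_simp
    refine ⟨s, hs, hs1, ?_⟩
    filter_upwards [hA, hup, habel] with N hAN hupN haN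
    have h1 : D N - K N s ≤ η / 2 := by linarith [hAN s hs hs1]
    -- `K N s - D N ≤ η/2`: let `s'' → 0⁺` in `K N s - K N s'' ≤ η/2`
    have hev : ∀ᶠ s'' in 𝓝[>] (0 : ℝ), K N s - η / 2 ≤ K N s'' := by
      have hmem : Set.Ioc (0 : ℝ) s ∈ 𝓝[>] (0 : ℝ) := Ioc_mem_nhdsGT hs
      filter_upwards [hmem] with s'' hs''
      have h := hupN s'' s hs''.1 hs''.2 hss₀
      linarith
    have h2 : K N s - η / 2 ≤ D N := ge_of_tendsto haN hev
    rw [abs_le]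
    constructor <;> linarith
  -- (c) `D` is Cauchy, hence convergent
  have hcauchy : CauchySeq D := by
    refine Metric.cauchySeq_iff.2 fun η hη => ?_
    obtain ⟨s, hs, hs1, hBN⟩ := hB (η / 4) (by positivity)
    obtain ⟨Λ, hΛ⟩ := htl s hs hs1
    have hΛ' : ∀ᶠ N in atTop, |K N s - Λ| < η / 4 := by
      have := (Metric.tendsto_nhds.mp hΛ) (η / 4) (by positivity)
      simpa only [Real.dist_eq] using this
    obtain ⟨N₁, hN₁⟩ := (hBN.and hΛ').exists_forall_of_atTop
    refine ⟨N₁, fun m hm n hn => ?_⟩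
    rw [Real.dist_eq]
    have hm' := hN₁ m hm
    have hn' := hN₁ n hn
    have e1 : |D m - Λ| < η / 2 := by
      calc |D m - Λ| ≤ |D m - K m s| + |K m s - Λ| := abs_sub_le _ _ _
        _ < η / 4 + η / 4 := by linarith [hm'.1, hm'.2]
        _ = η / 2 := by ring
    have e2 : |D n - Λ| < η / 2 := by
      calc |D n - Λ| ≤ |D n - K n s| + |K n s - Λ| := abs_sub_le _ _ _
        _ < η / 4 + η / 4 := by linarith [hn'.1, hn'.2]
        _ = η / 2 := by ring
    calc |D m - D n| ≤ |D m - Λ| + |Λ - D n| := abs_sub_le _ _ _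
      _ = |D m - Λ| + |D n - Λ| := by rw [abs_sub_comm Λ (D n)]
      _ < η := by linarith
  obtain ⟨κ, hκ⟩ := cauchySeq_tendsto_of_complete hcauchy
  -- (d) positivity from the floor on the Abel limits `D N = K N (0⁺)`
  have hκpos : 0 < κ := lt_of_lt_of_le hc (ge_of_tendsto hκ hfloor)
  exact ⟨κ, hκpos, hκ⟩


/-! ## Registered helpers (notation-free restatements) -/

/-- Registered helper sub-goal `helper_storageTelescope` of stub `stub_zeroFrequencyStorageDecay` (line
`abel-storage-decay`, crux stmt-AtomisticToContinuum-11977): THE TELESCOPE — a two-point Cauchy–Schwarz bound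
`(σ t' − σ t)² ≤ (t' − t)² N_t N_{t'}` plus the storage bound `t N_t ≤ C t^a` (`0 < a ≤ 1`) on `(0,1]` give the upper
modulus `σ s' − σ s ≤ (2C/a) s'^a` for `0 < s ≤ s' ≤ 1` (`telescope_le`, restated). [folklore] -/
theorem helper_storageTelescope : ∀ (σ N : ℝ → ℝ) (a C : ℝ), 0 < a → a ≤ 1 → 0 ≤ C → (∀ t : ℝ, 0 < t → t ≤ 1 → t * N t ≤ C * t ^ a) → (∀ t : ℝ, 0 < t → t ≤ 1 → 0 ≤ N t) → (∀ t t' : ℝ, 0 < t → t ≤ t' → t' ≤ 1 → (σ t' - σ t) ^ 2 ≤ (t' - t) ^ 2 * (N t * N t')) → ∀ s s' : ℝ, 0 < s → s ≤ s' → s' ≤ 1 → σ s' - σ s ≤ 2 * C / a * s' ^ a :=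
  fun _ _ _ _ ha ha1 hC hN hN0 hstep _ _ hs hss' hs'1 => telescope_le ha ha1 hC hN hN0 hstep hs hss' hs'1

/-- Registered helper sub-goal `helper_abelMooreOsgoodFloorD` of the composition of line `abel-storage-decay` (crux
stmt-AtomisticToContinuum-11977): the ONE-SIDED ABEL–MOORE–OSGOOD TRANSFER with the floor on the Abel limits
(`abel_mooreOsgood_floorD`, restated with `𝓝[>] 0` spelled `nhdsWithin 0 (Set.Ioi 0)`). [folklore] -/
theorem helper_abelMooreOsgoodFloorD : ∀ (K : ℕ → ℝ → ℝ) (D : ℕ → ℝ) (C c : ℝ), 0 < c → (∀ᶠ N in Filter.atTop, ∀ s s' : ℝ, 0 < s → s ≤ s' → s' ≤ 1 → -(C * (s' - s)) ≤ K N s' - K N s) → (∀ η : ℝ, 0 < η → ∃ s₀ : ℝ, 0 < s₀ ∧ s₀ ≤ 1 ∧ ∀ᶠ N in Filter.atTop, ∀ s s' : ℝ, 0 < s → s ≤ s' → s' ≤ s₀ → K N s' - K N s ≤ η) → (∀ᶠ N in Filter.atTop, Filter.Tendsto (K N) (nhdsWithin 0 (Set.Ioi 0)) (nhds (D N))) →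 (∀ s : ℝ, 0 < s → s ≤ 1 → ∃ Λ : ℝ, Filter.Tendsto (fun N : ℕ => K N s) Filter.atTop (nhds Λ)) → (∀ᶠ N in Filter.atTop, c ≤ D N) → ∃ κ : ℝ, 0 < κ ∧ Filter.Tendsto D Filter.atTop (nhds κ) :=
  fun K D C c hc hmono hupper habel htl hfloor => abel_mooreOsgood_floorD K D C c hc hmono hupper habel htl hfloor

end Summit.AtomisticToContinuum.FouriersLaw.Theorems.NoisyFourier.StorageDecay

end
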